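import Literature.IUT.HodgeArakelov.ThetaEvaluationModelEvDecompPoint
import Literature.IUT.HodgeArakelov.MonoThetaProjectiveThetaEnvProofs
import Literature.IUT.HodgeArakelov.EtaleThetaDataOfSettingInversion

/-!
# [IUTchII] Cor 1.12 (ii)∧(iii) at the model with `D_{μ_-} := D_y`: the REDUNDANT binders `hAβ`, `hH`, `hlim` also removed
# (proof companion; the residual list of the closer of record is now custody items only)

Proof-only sequel (abc-iut cell, D-0067 wave 4, seat abc-iut-w4-d043 gen 4; nodes **IUTchII:Cor1.12(ii)**,
**IUTchII:Cor1.12(iii)**) of `ThetaEvaluationModelEvDecompPoint.lean` (p437579: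
`EtaleLevels.cor112_model_of_cyclotomeTower_decompPoint` — Cor. 1.12 (ii) ∧ (iii) at the model `Π := Π^tp_X̲̲` for ONE
theta-evaluation datum with `D_{μ_-} := D_y` instantiated and `hDq`/`hDc`/finite index/`T2` discharged).  Three of that closer's
remaining binders are NOT inputs but consequences of the others, and are removed here:
* `hAβ : ∀ a, a ∈ l·Δ_Θ ↔ β a ∈ l·Δ_Θ` FOLLOWS from `hβ : β = id` on `l·Δ_Θ` (`mem_lDeltaTheta_iff_of_eq_self`: `β` injective);
* `hH : ∀ x, x ∈ Π_Ÿ(Π) ↔ α x ∈ Π_Ÿ(Π)` IS abc-iut-w5-d072's `EtaleThetaDataOfSetting.mem_PiYdd_iff_of_piYddCharacteristic C hcharY α`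
  (from (H1) `PiYddCharacteristic C`, already a binder);
* `hlim : Function.Bijective rigidLimHom` IS abc-iut-w4-d030's theorem `EtaleLevels.bijective_rigidLimHom` ([IUTchII] Prop. 1.5 (iii):
  the limit cyclotomic rigidity map is an isomorphism, from `hZ`).
`cor112_model_of_cyclotomeTower_decompPoint_min` = the same conclusion with those three terms substituted.  Its residual named
inputs are now custody items only: the Rmk. 1.4.1 (ii) inversion data `α, hover, δ, hδ, hαα, γ, hγ, hαγ, huniq` (GAP G-w4d010-2 (R1),
abc-iut-w5-d072; `huniq` tempered-anabelian), the POINT DATA «`y = μ_-`» (`hDmu`, `hfixD`, `etaStd`/`hmem`/`hstd` — print's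
[SemiAnbd] Thm. 6.8 (iii) reconstruction of the torsion point, [IUTchII] Cor. 2.4 (ii)(b) p. 70), the coefficient half `β`/`hφ`/`hβ`
and `hα`, the Prop. 2.2 (ii) translate inputs `τ`/`hτ`/`hdesc`/`hrev`/`hfree` (abc-iut-w5-d187), `hO` (F-2498), `hΔΘ` (G-w5d187-1 →
G-w4d021-2 class R), (H1) `hcharY`, the [AbsTopIII] producer's `ε`/`hΔX`/`hq` (L4), the L2 data `hC hS mods hmods f hf h15 L hZ` and the
L3 parameter bundle `gd`.  No definition, no `Prop`-valued fact; nothing of the parents is restated.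

S. Mochizuki, *Inter-universal Teichmüller theory II*, kurims manuscript (Dec. 2020), Cor. 1.12 (ii), (iii) pp. 56–58, Rmk. 1.4.1 (ii)
p. 28, Prop. 1.5 (iii) p. 29 [claim: Mochizuki2012, status: disputed] (IUTchII §1 Cor 1.12, kurims pp.56-58).  Claim key DISPUTED
(D-0012); nothing here takes a side on [IUTchIII] Cor. 3.12; instantiated ≠ endorsed; typed ≠ proved for the named inputs.
-/

noncomputable section

namespace Literature.IUT.HodgeArakelov

open Literature.AnabelianGeometry.EtaleTheta Literature.AnabelianGeometry.SemiGraphs CohomologySystemOfContH1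
open Literature.AnabelianGeometry.AbsoluteAnabelian
open scoped Literature.AnabelianGeometry.EtaleTheta

/-! ## §1. `hAβ` from `hβ` -/

namespace EtaleThetaDataOfSetting

variable {p : ℕ} [Fact p.Prime] {D : Literature.AnabelianGeometry.EtaleTheta.ThetaSetting p} {l : ℕ}

/-- If a (topological) automorphism `β` of `(Π^tp_X)^Θ` restricts to the identity on `l·Δ_Θ` (the binder `hβ` of the Cor. 1.12
model closers), then membership in `l·Δ_Θ` is `β`-invariant (their binder `hAβ`): `a ∈ l·Δ_Θ ↔ β a ∈ l·Δ_Θ` — the converse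
direction because `β (β a) = β a` forces `β a = a` by injectivity. [claim: Mochizuki2012, status: disputed] (IUTchII §1 Cor 1.12 (ii), kurims p.57) -/
theorem mem_lDeltaTheta_iff_of_eq_self (β : D.GtpTheta ≃ₜ* D.GtpTheta) (hβ : ∀ a ∈ D.lDeltaTheta l, β a = a)
    (a : D.GtpTheta) : a ∈ D.lDeltaTheta l ↔ β a ∈ D.lDeltaTheta l := by
  constructor
  · intro ha
    rw [hβ a ha]
    exact ha
  · intro hβa
    have h : β (β a) = β a := hβ (β a) hβa
    have h' : β a = a := β.injective h
    rw [← h']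
    exact hβa

end EtaleThetaDataOfSetting

/-! ## §2. The closer of record with `hAβ`, `hH`, `hlim` substituted -/

namespace EtaleLevels

variable {p : ℕ} [Fact p.Prime] {D : Literature.AnabelianGeometry.EtaleTheta.ThetaSetting p}
  {E : D.EtaleThetaData} {l : ℕ} (C : E.DoubleUnderline l) (hC : D.Compat) (hS : D.Sec2Hyps)
  (hl : l.Prime) (hp2 : p ≠ 2) (hpl : p ≠ l) (hζ : ∃ ζ : D.K, IsPrimitiveRoot ζ (4 * l))
  (mods : ∀ M : ℕ+, D.CyclotomeMod l M)
  (f : contCocycles D.toTheta D.DeltaTheta C.GtpYdduu) (hf : f ∈ C.rootCocycles hC)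
  (hmods : ∀ (M M' : ℕ+) (h : (M : ℕ) ∣ (M' : ℕ)) (x : D.lDeltaTheta l),
    MuN.red p M M' h ((mods M').red x) = (mods M).red x)
  (h15 : Literature.AnabelianGeometry.EtaleTheta.ThetaSetting.Prop15iii E hC) (L : C.CuspLabels)
  (hZ : ∀ M : ℕ+, Nonempty (ModelCyclotomes.lDeltaQuot (C.rigidData (mods M) hC hS h15 L) ≃*
    Literature.IUT.HodgeTheaters.ZHat))
  (hcharY : EtaleThetaDataOfSetting.PiYddCharacteristic C)
  (Env : EnvOfGroup (setting C hC hS hl hp2 hpl hζ mods f hf)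
    (modelSystem C hC hS hl hp2 hpl hζ mods f hf hmods h15 L hZ).PiX)
  -- the model pointed inversion (abc-iut-w5-d072's `pointedInversionOfPair`): its named print inputs
  (α : (EtaleThetaDataOfSetting.Pi C) ≃ₜ* (EtaleThetaDataOfSetting.Pi C))
  (hover : ∀ x : EtaleThetaDataOfSetting.Pi C, Env.recon.projG (Env.isoX (α x)) = Env.recon.projG (Env.isoX x))
  (δ : EtaleThetaDataOfSetting.Pi C) (hδ : Env.recon.projG (Env.isoX δ) = 1)
  (hαα : ∀ x : EtaleThetaDataOfSetting.Pi C, α (α x) = δ * x * δ⁻¹)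
  (γ : EtaleThetaDataOfSetting.Pi C) (hγ : C.toLZ γ = Multiplicative.ofAdd 1)
  (hαγ : C.toLZ (α γ) = Multiplicative.ofAdd (-1))
  (huniq : ∀ κ : (EtaleThetaDataOfSetting.Pi C) ≃ₜ* (EtaleThetaDataOfSetting.Pi C),
    (∀ x, Env.recon.projG (Env.isoX (κ x)) = Env.recon.projG (Env.isoX x)) →
    (∃ δ' : EtaleThetaDataOfSetting.Pi C, Env.recon.projG (Env.isoX δ') = 1 ∧ ∀ x, κ (κ x) = δ' * x * δ'⁻¹) →
    (¬ ∃ δ' : EtaleThetaDataOfSetting.Pi C, Env.recon.projG (Env.isoX δ') = 1 ∧ ∀ x, κ x = δ' * x * δ'⁻¹) →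
      ∃ δ' : EtaleThetaDataOfSetting.Pi C, Env.recon.projG (Env.isoX δ') = 1 ∧ ∀ x, κ x = δ' * α x * δ'⁻¹)
  -- the L3 parameter bundle «`Π^temp` tempered, Galois-countable» of `X_v`, and the POINT: a non-cuspidal closed point `y` of
  -- the tree's tempered curve `X̲̲_v`, whose decomposition group `D_y ⊆ Π^tp_X̲̲` instantiates print's `D_{μ_-}`
  (gd : D.toTemperedCurve.GroupLevelData)
  (y : (C.temperedCurveXuuOfLevelData hl.ne_zero gd).Pt) (hy : ¬ (C.temperedCurveXuuOfLevelData hl.ne_zero gd).IsCusp y)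
  -- what «`y = μ_-`» means in print: `D_{μ_-} ⊆ Π_Ÿ(Π)`, fixed by `ι_Ÿ` up to `Δ`-conjugacy, standard type at `D_{μ_-}`
  (hDmu : (((C.temperedCurveXuuOfLevelData hl.ne_zero gd).decomp y : Subgroup (EtaleThetaDataOfSetting.Pi C))) ≤
    EtaleThetaDataOfSetting.PiYdd C)
  (hfixD : ∃ δ' : ↥(EtaleThetaDataOfSetting.PiYdd C), Env.recon.projG (Env.isoX (δ' : EtaleThetaDataOfSetting.Pi C)) = 1 ∧
    ∀ (d : EtaleThetaDataOfSetting.Pi C) (hd : d ∈ ((C.temperedCurveXuuOfLevelData hl.ne_zero gd).decomp y)),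
      ((EtaleThetaDataOfSetting.iotaYddOfAut C hcharY α ⟨d, hDmu hd⟩ :
      EtaleThetaDataOfSetting.PiYdd C) : EtaleThetaDataOfSetting.Pi C) ∈
        (((C.temperedCurveXuuOfLevelData hl.ne_zero gd).decomp y : Subgroup (EtaleThetaDataOfSetting.Pi C))).map
          (MulAut.conj ((δ' : EtaleThetaDataOfSetting.PiYdd C) : EtaleThetaDataOfSetting.Pi C)).toMonoidHom)
  (etaStd : (EtaleThetaDataOfSetting.coh C).H1 ⊤) (hmem : etaStd ∈ EtaleThetaDataOfSetting.orbitOne C hC)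
  (hstd : (2 * (setting C hC hS hl hp2 hpl hζ mods f hf).l) •
    EtaleThetaDataOfSetting.resDmuOf C ((C.temperedCurveXuuOfLevelData hl.ne_zero gd).decomp y) hDmu etaStd = 0)
  -- the coefficient half of the pair and its printed properties
  (β : D.GtpTheta ≃ₜ* D.GtpTheta)
  (hφ : ∀ g, β (EtaleThetaDataOfSetting.phi C g) = EtaleThetaDataOfSetting.phi C (α g))
  -- the GENUINE [AbsTopIII]-output data: base MLF `k ⊆ ℚ̄_p` (finite over `ℚ_p`, `k̄ = ℚ̄_p`), model identification `ε`,
  -- (H1) `Δ` characteristic, (H2) `Π/Δ ≅ G_k`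
  (k : Type) [Field k] [ValuativeRel k] [TopologicalSpace k] [IsNonarchimedeanLocalField k] [CharZero k]
  [Algebra k (PadicAlgCl p)] [IsAlgClosure k (PadicAlgCl p)]
  [Algebra ℚ_[p] k] [FiniteDimensional ℚ_[p] k] [IsScalarTower ℚ_[p] k (PadicAlgCl p)]
  (ε : (setting C hC hS hl hp2 hpl hζ mods f hf).Gk ≃ₜ*
    (ModelMLFGaloisData.galois ({ k := k, K := PadicAlgCl p } : MLFClosure.{0}).k
      ({ k := k, K := PadicAlgCl p } : MLFClosure.{0}).K).tmPair.Pi)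
  (hΔX : ∀ φ : (setting C hC hS hl hp2 hpl hζ mods f hf).PiX ≃ₜ* (setting C hC hS hl hp2 hpl hζ mods f hf).PiX,
    (setting C hC hS hl hp2 hpl hζ mods f hf).DeltaX.map φ.toMulEquiv.toMonoidHom =
      (setting C hC hS hl hp2 hpl hζ mods f hf).DeltaX)
  (hq : Nonempty (TopGroup.quot (setting C hC hS hl hp2 hpl hζ mods f hf).PiX (setting C hC hS hl hp2 hpl hζ mods f hf).DeltaX ≃ₜ*
    (setting C hC hS hl hp2 hpl hζ mods f hf).Gk))

/-- **[IUTchII] Cor. 1.12 (ii) AND (iii) at the model `Π := Π^tp_X̲̲`, ONE theta-evaluation datum, `D_{μ_-} := D_y`, with the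
redundant binders `hAβ`, `hH`, `hlim` REMOVED** (in addition to `hDq`/`hDc`/finite index/`T2` removed by
`cor112_model_of_cyclotomeTower_decompPoint`): `hAβ := mem_lDeltaTheta_iff_of_eq_self β hβ`, `hH :=` abc-iut-w5-d072's
`mem_PiYdd_iff_of_piYddCharacteristic C hcharY α`, `hlim :=` abc-iut-w4-d030's `bijective_rigidLimHom`.  Conclusion verbatim that of
p430492/p437579: a bijective change of coefficient cyclotome `cU` inverse to the model's identifications such that the typed `Cor112_ii`
holds AND the typed diagram `(†μ,×μ)` over the FULLY GENUINE [AbsTopIII]-output data `genuineOfModelIsm` exists with last arrow the genuine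
`Ism(G)`-orbit.  Residual named inputs (custody items only): `α hover δ hδ hαα γ hγ hαγ huniq` (Rmk. 1.4.1 (ii) inversion, (R1)),
«`y = μ_-`» (`hDmu hfixD etaStd hmem hstd`), `β hφ hβ hα`, `τ hτ hdesc hrev hfree` (Prop. 2.2 (ii)), `hO` (F-2498), `hΔΘ` (G-w5d187-1),
`hcharY` (H1), the producer's `ε hΔX hq`, the L2 data and the L3 bundle `gd`. [claim: Mochizuki2012, status: disputed]
(IUTchII §1 Cor 1.12 (ii)(iii), kurims pp.56-58) -/
theorem cor112_model_of_cyclotomeTower_decompPoint_min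
    (hO : D.IsEtThOrigin) (hΔΘ : IsCompact (D.DeltaTheta : Set D.GtpTheta))
    (hα : ∀ x, EtaleThetaDataOfSetting.aug C (α x) = EtaleThetaDataOfSetting.aug C x)
    (hβ : ∀ a : D.GtpTheta, a ∈ D.lDeltaTheta l → β a = a)
    (τ : ℤ → (EtaleThetaDataOfSetting.coh C).H1 ⊤) (hτ : τ 0 = etaStd)
    (hdesc : ∀ o ∈ EtaleThetaDataOfSetting.orbitOne C hC,
      ∃ (n : ℤ) (c' : (EtaleThetaDataOfSetting.coh C).H1 ⊤), 2 • c' = 0 ∧ o = τ n + c')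
    (hrev : ∀ n : ℤ, IsOfFinAddOrder (EtaleThetaDataOfSetting.pairRho C α β hφ (EtaleThetaDataOfSetting.mem_lDeltaTheta_iff_of_eq_self β hβ) (EtaleThetaDataOfSetting.mem_PiYdd_iff_of_piYddCharacteristic C hcharY α) (τ n) - τ (-n)))
    (hfree : ∀ m n : ℤ, IsOfFinAddOrder (τ m - τ n) → m = n)
    (G : IsoClass (setting C hC hS hl hp2 hpl hζ mods f hf).Gk) :
    haveI := EtaleThetaDataOfSetting.finiteIndex_map_aug_decompPoint C hl.ne_zero gd y
    ∃ cU : CyclotomeCoefficients (EtaleThetaDataOfSetting.phi C) (D.lDeltaTheta l) (PadicAlgCl p)ˣ,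
      Function.Bijective cU.hom ∧
      (∀ (ζ : Literature.AnabelianGeometry.EtaleTheta.cyclotome (PadicAlgCl p)ˣ) (M : ℕ+),
        (((mods M).red (cU.hom ζ) : MuN p M) : (PadicAlgCl p)ˣ) = (ζ : ℕ+ → (PadicAlgCl p)ˣ) M) ∧
      Literature.IUT.HodgeArakelov.Cor112_ii
        (thetaEvaluation C hC hS hl hp2 hpl hζ mods f hf hmods h15 L hZ hcharY (bijective_rigidLimHom C hC hS hl hp2 hpl hζ mods f hf hmods h15 L hZ) Env
          (EtaleThetaDataOfSetting.pointedInversionOfPair C hC hS hcharY (setting C hC hS hl hp2 hpl hζ mods f hf)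
            (ContinuousMulEquiv.refl _) rfl Env α hover δ hδ hαα γ hγ hαγ huniq ((C.temperedCurveXuuOfLevelData hl.ne_zero gd).decomp y) hDmu hfixD etaStd hmem hstd)
          (LevelRetraction.ofAugmentation (EtaleThetaDataOfSetting.phi C) (D.lDeltaTheta l)
            (EtaleThetaDataOfSetting.aug C) ((C.temperedCurveXuuOfLevelData hl.ne_zero gd).decomp y) (EtaleThetaDataOfSetting.decompPoint_eq_one_of_aug_eq_one C hl.ne_zero gd y hy) (EtaleThetaDataOfSetting.PiYdd C)
            (EtaleThetaDataOfSetting.continuous_aug C) (aug_ker_acts_trivially C)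
            (hlift_of_isCompact (EtaleThetaDataOfSetting.aug C) ((C.temperedCurveXuuOfLevelData hl.ne_zero gd).decomp y) (EtaleThetaDataOfSetting.continuous_aug C) (EtaleThetaDataOfSetting.isCompact_decompPoint C hl.ne_zero gd y))
            (hemb_of_isCompact (EtaleThetaDataOfSetting.aug C) ((C.temperedCurveXuuOfLevelData hl.ne_zero gd).decomp y) (EtaleThetaDataOfSetting.continuous_aug C) (EtaleThetaDataOfSetting.isCompact_decompPoint C hl.ne_zero gd y) (EtaleThetaDataOfSetting.decompPoint_eq_one_of_aug_eq_one C hl.ne_zero gd y hy)))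
          cU (EtaleThetaDataOfSetting.isOpen_stabilizer_units C) (EtaleThetaDataOfSetting.finiteIndex_stabilizer_units C)
          (unitGroup ℚ_[p] (PadicAlgCl p)) (EtaleThetaDataOfSetting.pairRhoLim C α β hφ (EtaleThetaDataOfSetting.mem_lDeltaTheta_iff_of_eq_self β hβ) (EtaleThetaDataOfSetting.mem_PiYdd_iff_of_piYddCharacteristic C hcharY α))) ∧
      ∃ Δ : MuXmuDiagram
          (thetaEvaluation C hC hS hl hp2 hpl hζ mods f hf hmods h15 L hZ hcharY (bijective_rigidLimHom C hC hS hl hp2 hpl hζ mods f hf hmods h15 L hZ) Env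
            (EtaleThetaDataOfSetting.pointedInversionOfPair C hC hS hcharY (setting C hC hS hl hp2 hpl hζ mods f hf)
              (ContinuousMulEquiv.refl _) rfl Env α hover δ hδ hαα γ hγ hαγ huniq ((C.temperedCurveXuuOfLevelData hl.ne_zero gd).decomp y) hDmu hfixD etaStd hmem hstd)
            (LevelRetraction.ofAugmentation (EtaleThetaDataOfSetting.phi C) (D.lDeltaTheta l)
              (EtaleThetaDataOfSetting.aug C) ((C.temperedCurveXuuOfLevelData hl.ne_zero gd).decomp y) (EtaleThetaDataOfSetting.decompPoint_eq_one_of_aug_eq_one C hl.ne_zero gd y hy) (EtaleThetaDataOfSetting.PiYdd C)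
              (EtaleThetaDataOfSetting.continuous_aug C) (aug_ker_acts_trivially C)
              (hlift_of_isCompact (EtaleThetaDataOfSetting.aug C) ((C.temperedCurveXuuOfLevelData hl.ne_zero gd).decomp y) (EtaleThetaDataOfSetting.continuous_aug C) (EtaleThetaDataOfSetting.isCompact_decompPoint C hl.ne_zero gd y))
              (hemb_of_isCompact (EtaleThetaDataOfSetting.aug C) ((C.temperedCurveXuuOfLevelData hl.ne_zero gd).decomp y) (EtaleThetaDataOfSetting.continuous_aug C) (EtaleThetaDataOfSetting.isCompact_decompPoint C hl.ne_zero gd y) (EtaleThetaDataOfSetting.decompPoint_eq_one_of_aug_eq_one C hl.ne_zero gd y hy)))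
            cU (EtaleThetaDataOfSetting.isOpen_stabilizer_units C) (EtaleThetaDataOfSetting.finiteIndex_stabilizer_units C)
            (unitGroup ℚ_[p] (PadicAlgCl p)) (EtaleThetaDataOfSetting.pairRhoLim C α β hφ (EtaleThetaDataOfSetting.mem_lDeltaTheta_iff_of_eq_self β hβ) (EtaleThetaDataOfSetting.mem_PiYdd_iff_of_piYddCharacteristic C hcharY α)))
          (AbsTopMonoids.genuineOfModelIsm (setting C hC hS hl hp2 hpl hζ mods f hf) { k := k, K := PadicAlgCl p } ε hΔX hq) G
          ↥(AddCommGroup.torsion (thetaEnvData C hC hS hl hp2 hpl hζ mods f hf hmods h15 L hZ hcharY (bijective_rigidLimHom C hC hS hl hp2 hpl hζ mods f hf hmods h15 L hZ)).cohEnv.lim)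
          (AddCommGroup.torsion (thetaEnvData C hC hS hl hp2 hpl hζ mods f hf hmods h15 L hZ hcharY (bijective_rigidLimHom C hC hS hl hp2 hpl hζ mods f hf hmods h15 L hZ)).cohEnv.lim).subtype,
        Δ.poly₄₅ = {e | ∃ (φ : AbsTopMonoids.Genuine.qObj hq (IsoClass.base (setting C hC hS hl hp2 hpl hζ mods f hf).PiX) ⟶ G)
            (gI : (AbsTopMonoids.genuineOfModelIsm (setting C hC hS hl hp2 hpl hζ mods f hf) { k := k, K := PadicAlgCl p }
              ε hΔX hq).Ism G),
          ∀ (u : ↥(unitGroup ℚ_[p] (PadicAlgCl p)))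
            (m : ↥(thetaEvaluation C hC hS hl hp2 hpl hζ mods f hf hmods h15 L hZ hcharY (bijective_rigidLimHom C hC hS hl hp2 hpl hζ mods f hf hmods h15 L hZ) Env
              (EtaleThetaDataOfSetting.pointedInversionOfPair C hC hS hcharY (setting C hC hS hl hp2 hpl hζ mods f hf)
                (ContinuousMulEquiv.refl _) rfl Env α hover δ hδ hαα γ hγ hαγ huniq ((C.temperedCurveXuuOfLevelData hl.ne_zero gd).decomp y) hDmu hfixD etaStd hmem hstd)
              (LevelRetraction.ofAugmentation (EtaleThetaDataOfSetting.phi C) (D.lDeltaTheta l)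
                (EtaleThetaDataOfSetting.aug C) ((C.temperedCurveXuuOfLevelData hl.ne_zero gd).decomp y) (EtaleThetaDataOfSetting.decompPoint_eq_one_of_aug_eq_one C hl.ne_zero gd y hy) (EtaleThetaDataOfSetting.PiYdd C)
                (EtaleThetaDataOfSetting.continuous_aug C) (aug_ker_acts_trivially C)
                (hlift_of_isCompact (EtaleThetaDataOfSetting.aug C) ((C.temperedCurveXuuOfLevelData hl.ne_zero gd).decomp y) (EtaleThetaDataOfSetting.continuous_aug C) (EtaleThetaDataOfSetting.isCompact_decompPoint C hl.ne_zero gd y))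
                (hemb_of_isCompact (EtaleThetaDataOfSetting.aug C) ((C.temperedCurveXuuOfLevelData hl.ne_zero gd).decomp y) (EtaleThetaDataOfSetting.continuous_aug C) (EtaleThetaDataOfSetting.isCompact_decompPoint C hl.ne_zero gd y) (EtaleThetaDataOfSetting.decompPoint_eq_one_of_aug_eq_one C hl.ne_zero gd y hy)))
              cU (EtaleThetaDataOfSetting.isOpen_stabilizer_units C) (EtaleThetaDataOfSetting.finiteIndex_stabilizer_units C)
              (unitGroup ℚ_[p] (PadicAlgCl p)) (EtaleThetaDataOfSetting.pairRhoLim C α β hφ (EtaleThetaDataOfSetting.mem_lDeltaTheta_iff_of_eq_self β hβ) (EtaleThetaDataOfSetting.mem_PiYdd_iff_of_piYddCharacteristic C hcharY α))).MxTM)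
            (w : (nonzeroIntegers k (PadicAlgCl p))ˣ),
            (m : (thetaEvaluation C hC hS hl hp2 hpl hζ mods f hf hmods h15 L hZ hcharY (bijective_rigidLimHom C hC hS hl hp2 hpl hζ mods f hf hmods h15 L hZ) Env
              (EtaleThetaDataOfSetting.pointedInversionOfPair C hC hS hcharY (setting C hC hS hl hp2 hpl hζ mods f hf)
                (ContinuousMulEquiv.refl _) rfl Env α hover δ hδ hαα γ hγ hαγ huniq ((C.temperedCurveXuuOfLevelData hl.ne_zero gd).decomp y) hDmu hfixD etaStd hmem hstd)
              (LevelRetraction.ofAugmentation (EtaleThetaDataOfSetting.phi C) (D.lDeltaTheta l)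
                (EtaleThetaDataOfSetting.aug C) ((C.temperedCurveXuuOfLevelData hl.ne_zero gd).decomp y) (EtaleThetaDataOfSetting.decompPoint_eq_one_of_aug_eq_one C hl.ne_zero gd y hy) (EtaleThetaDataOfSetting.PiYdd C)
                (EtaleThetaDataOfSetting.continuous_aug C) (aug_ker_acts_trivially C)
                (hlift_of_isCompact (EtaleThetaDataOfSetting.aug C) ((C.temperedCurveXuuOfLevelData hl.ne_zero gd).decomp y) (EtaleThetaDataOfSetting.continuous_aug C) (EtaleThetaDataOfSetting.isCompact_decompPoint C hl.ne_zero gd y))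
                (hemb_of_isCompact (EtaleThetaDataOfSetting.aug C) ((C.temperedCurveXuuOfLevelData hl.ne_zero gd).decomp y) (EtaleThetaDataOfSetting.continuous_aug C) (EtaleThetaDataOfSetting.isCompact_decompPoint C hl.ne_zero gd y) (EtaleThetaDataOfSetting.decompPoint_eq_one_of_aug_eq_one C hl.ne_zero gd y hy)))
              cU (EtaleThetaDataOfSetting.isOpen_stabilizer_units C) (EtaleThetaDataOfSetting.finiteIndex_stabilizer_units C)
              (unitGroup ℚ_[p] (PadicAlgCl p)) (EtaleThetaDataOfSetting.pairRhoLim C α β hφ (EtaleThetaDataOfSetting.mem_lDeltaTheta_iff_of_eq_self β hβ) (EtaleThetaDataOfSetting.mem_PiYdd_iff_of_piYddCharacteristic C hcharY α))).Hd) =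
                Multiplicative.toAdd (h1LimKummer (EtaleThetaDataOfSetting.phi C) (D.lDeltaTheta l) ((C.temperedCurveXuuOfLevelData hl.ne_zero gd).decomp y) cU
                  (EtaleThetaDataOfSetting.isOpen_stabilizer_units C) (EtaleThetaDataOfSetting.finiteIndex_stabilizer_units C) u) →
            ((w : nonzeroIntegers k (PadicAlgCl p)) : PadicAlgCl p) = ((u : (PadicAlgCl p)ˣ) : PadicAlgCl p) →
              e (Multiplicative.ofAdd (QuotientAddGroup.mk m)) =
                (AbsTopMonoids.genuineOfModelIsm (setting C hC hS hl hp2 hpl hζ mods f hf) { k := k, K := PadicAlgCl p }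
                    ε hΔX hq).actIsm G gI
                  (QuotientGroup.mk (Units.map (AbsTopMonoids.Genuine.liftM ({ k := k, K := PadicAlgCl p } : MLFClosure.{0})
                    (AbsTopMonoids.Genuine.phiOf ({ k := k, K := PadicAlgCl p } : MLFClosure.{0}) ε φ)).toMonoidHom w))} :=
  cor112_model_of_cyclotomeTower_decompPoint C hC hS hl hp2 hpl hζ mods f hf hmods h15 L hZ hcharY
    (bijective_rigidLimHom C hC hS hl hp2 hpl hζ mods f hf hmods h15 L hZ) Env α hover δ hδ hαα γ hγ hαγ huniq gd y hy hDmu hfixD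
    etaStd hmem hstd β hφ (EtaleThetaDataOfSetting.mem_lDeltaTheta_iff_of_eq_self β hβ)
    (EtaleThetaDataOfSetting.mem_PiYdd_iff_of_piYddCharacteristic C hcharY α) k ε hΔX hq hO hΔΘ hα hβ τ hτ hdesc hrev hfree G

end EtaleLevels

end Literature.IUT.HodgeArakelov

end
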